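import Summits.QuantumFields.GaugeBoot.DiagonalRPTorusHexLocalRest
import Summits.QuantumFields.GaugeBoot.DiagonalRPTorusTubeRingsOdd
import HarnessLib

/-!
# The local `ℤ³` chart: the rest test for ODD tori (gauge-boot, L3 `d = 3` uniform window, odd leg, brick 1)

HONEST FRAMING (cell `pub-gaugeboot`, page 1 of every file): the venture produces certified bounds
on lattice expectations at stated coupling, gauge group, dimension and torus size; NOT a mass gap,
NOT a continuum limit, NOT a string tension; NOT Yang–Mills-summit-bearing (barriers
`FixedCouplingUltralocality`, `PerturbativeInvisibility`). This module is bookkeeping for a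
structural NEGATIVE result (a coupling window UNIFORM in the torus size for the failure of
closed-half diagonal reflection positivity on `(ℤ/L)^3`, `L` odd); it discharges nothing by itself.

## Content (chart `DiagRPHex.site y`, torus `(ℤ/L)^3`, `L = 2c + 1`, closed half `h = c + 1`,
base on the LAST layer of the half, `δ(y) = c`)

For odd `L` the rest plaquettes of the half-action trick (`DiagRPTube.restPlaqs 0 1 (c+1)`) are
the plaquettes STRADDLING the cut between the layers `c` and `c + 1 = -c`: in the chart, a vertex
with `loff ≤ 0` and a vertex with `loff ≥ 1`.

* `lrestOdd` — the local test (a vertex off the half and a vertex whose mirror image is off the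
  half put a plaquette in the rest: `DiagRPTube.mem_restPlaqs_of_verts`);
* ★ `mem_restPlaqs_of_lrestOdd` / `lrestOdd_of_mem_restPlaqs` — on the box (`2B + 2 < c`) the local
  test IS membership in `restPlaqs 0 1 (c+1)`.

Elementary bookkeeping; no named fact.
-/

open Finset Function

namespace Summit.QuantumFields.GaugeBoot

open Literature.MathematicalPhysics.QuantumFieldTheory

namespace DiagRPHex

open DiagRPTube

/-- Local rest test for odd tori: a vertex on or below the base layer and a vertex above it. -/
def lrestOdd (p : LPlaq) : Bool :=
  ((loff (lvert p 0) ≤ 0) || (loff (lvert p 1) ≤ 0) || (loff (lvert p 2) ≤ 0) || (loff (lvert p 3) ≤ 0)) &&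
    ((1 ≤ loff (lvert p 0)) || (1 ≤ loff (lvert p 1)) || (1 ≤ loff (lvert p 2)) || (1 ≤ loff (lvert p 3)))

/-- Unfolding `lrestOdd`. -/
theorem lrestOdd_iff (p : LPlaq) :
    lrestOdd p = true ↔ (∃ a, loff (lvert p a) ≤ 0) ∧ ∃ a, 1 ≤ loff (lvert p a) := by
  simp only [lrestOdd, Bool.and_eq_true, Bool.or_eq_true, decide_eq_true_eq]
  constructor
  · rintro ⟨h1, h2⟩
    refine ⟨?_, ?_⟩
    · rcases h1 with ((h | h) | h) | h
      exacts [⟨0, h⟩, ⟨1, h⟩, ⟨2, h⟩, ⟨3, h⟩]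
    · rcases h2 with ((h | h) | h) | h
      exacts [⟨0, h⟩, ⟨1, h⟩, ⟨2, h⟩, ⟨3, h⟩]
  · rintro ⟨⟨a, ha⟩, ⟨b, hb⟩⟩
    refine ⟨?_, ?_⟩
    · fin_cases a
      · exact Or.inl (Or.inl (Or.inl ha))
      · exact Or.inl (Or.inl (Or.inr ha))
      · exact Or.inl (Or.inr ha)
      · exact Or.inr ha
    · fin_cases b
      · exact Or.inl (Or.inl (Or.inl hb))
      · exact Or.inl (Or.inl (Or.inr hb))
      · exact Or.inl (Or.inr hb)
      · exact Or.inr hb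


section Chart

variable {L : ℕ} (y : Site 3 L) [NeZero L] {c : ℕ}

variable {y}

/-- ★ **The local test implies membership in the rest** (odd torus, base layer `δ(y) = c`,
plaquettes of the box, `B + 1 < c`). -/
theorem mem_restPlaqs_of_lrestOdd (hL : L = 2 * c + 1) (hy : lay (0 : Fin 3) 1 y = ((c : ℕ) : ZMod L))
    {B : ℕ} (hBc : 2 * B + 2 < c) {p : LPlaq} (hp : InBox B p.1) (h : lrestOdd p = true) :
    plaq y p ∈ restPlaqs (0 : Fin 3) 1 (c + 1) := by
  obtain ⟨⟨a, ha⟩, ⟨b, hb⟩⟩ := (lrestOdd_iff p).1 h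
  have habs := abs_loff_lvert_le hp
  refine DiagRPTube.mem_restPlaqs_of_verts b a ?_ ?_
  · -- the vertex above the cut lies off the half: layer `c + k`, `1 ≤ k ≤ 2B+1`
    obtain ⟨k, hk1, hk, hkb⟩ : ∃ k : ℕ, 1 ≤ k ∧ k ≤ 2 * B + 1 ∧ loff (lvert p b) = (k : ℤ) := by
      refine ⟨(loff (lvert p b)).toNat, ?_, ?_, ?_⟩
      · have := hb; omega
      · have := (abs_le.1 (habs b)).2; omega
      · have := hb; omega
    rw [vert_plaq, lay_site, hy, hkb]
    have : ((c : ℕ) : ZMod L) + ((k : ℤ) : ZMod L) = ((c + k : ℕ) : ZMod L) := by push_cast; ring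
    rw [this, val_cast (by omega)]
    omega
  · -- the vertex on or below the base layer has its mirror image off the half
    obtain ⟨k, hk, hka⟩ : ∃ k : ℕ, k ≤ 2 * B + 1 ∧ loff (lvert p a) = -(k : ℤ) := by
      refine ⟨(-loff (lvert p a)).toNat, ?_, ?_⟩
      · have := (abs_le.1 (habs a)).1; omega
      · have := ha; omega
    rw [vert_plaq, lay_site, hy, hka]
    have : -(((c : ℕ) : ZMod L) + ((-(k : ℤ) : ℤ) : ZMod L)) = ((c + 1 + k : ℕ) : ZMod L) := by
      have hL0 : ((2 * c + 1 : ℕ) : ZMod L) = 0 := by rw [← hL]; exact ZMod.natCast_self L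
      push_cast at hL0 ⊢
      linear_combination -hL0
    rw [this, val_cast (by omega)]
    omega

/-- ★ **Membership in the rest implies the local test** (odd torus, plaquettes of the box). -/
theorem lrestOdd_of_mem_restPlaqs (hL : L = 2 * c + 1) (hy : lay (0 : Fin 3) 1 y = ((c : ℕ) : ZMod L))
    {B : ℕ} (hBc : 2 * B + 2 < c) {p : LPlaq} (hp : InBox B p.1)
    (h : plaq y p ∈ restPlaqs (0 : Fin 3) 1 (c + 1)) : lrestOdd p = true := by
  by_contra hne
  have habs := abs_loff_lvert_le hp
  have hcases : (∀ a, loff (lvert p a) ≤ 0) ∨ (∀ a, 1 ≤ loff (lvert p a)) := by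
    by_contra hc
    push Not at hc
    obtain ⟨⟨a, ha⟩, ⟨b, hb⟩⟩ := hc
    exact hne ((lrestOdd_iff p).2 ⟨⟨b, by omega⟩, ⟨a, by omega⟩⟩)
  rcases hcases with hlow | hhigh
  · -- all vertices on the layers `c - k`, `0 ≤ k ≤ 2B+1`: inner
    refine not_mem_restPlaqs_of_layers (i := (0 : Fin 3)) (j := 1) (h := c + 1) (fun a => ?_) ⟨0, ?_⟩ h
    · obtain ⟨k, hk, hka⟩ : ∃ k : ℕ, k ≤ 2 * B + 1 ∧ loff (lvert p a) = -(k : ℤ) := by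
        refine ⟨(-loff (lvert p a)).toNat, ?_, ?_⟩
        · have := (abs_le.1 (habs a)).1; omega
        · have := hlow a; omega
      rw [vert_plaq, lay_site, hy, hka]
      have : ((c : ℕ) : ZMod L) + ((-(k : ℤ) : ℤ) : ZMod L) = ((c - k : ℕ) : ZMod L) := by
        rw [Nat.cast_sub (by omega)]; push_cast; ring
      rw [this, val_cast (by omega)]
      omega
    · obtain ⟨k, hk, hka⟩ : ∃ k : ℕ, k ≤ 2 * B + 1 ∧ loff (lvert p 0) = -(k : ℤ) := by
        refine ⟨(-loff (lvert p 0)).toNat, ?_, ?_⟩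
        · have := (abs_le.1 (habs 0)).1; omega
        · have := hlow 0; omega
      rw [vert_plaq, lay_site, hy, hka]
      have : ((c : ℕ) : ZMod L) + ((-(k : ℤ) : ℤ) : ZMod L) = ((c - k : ℕ) : ZMod L) := by
        rw [Nat.cast_sub (by omega)]; push_cast; ring
      rw [this]
      intro h0
      have := congrArg ZMod.val h0
      rw [val_cast (by omega), ZMod.val_zero] at this
      omega
  · -- all vertices on the layers `c + k`, `1 ≤ k ≤ 2B+1`: mirror images of inner ones
    refine not_mem_restPlaqs_of_neg_layers (i := (0 : Fin 3)) (j := 1) (h := c + 1) (fun a => ?_) ⟨0, ?_⟩ h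
    · obtain ⟨k, hk1, hk, hka⟩ : ∃ k : ℕ, 1 ≤ k ∧ k ≤ 2 * B + 1 ∧ loff (lvert p a) = (k : ℤ) := by
        refine ⟨(loff (lvert p a)).toNat, ?_, ?_, ?_⟩
        · have := hhigh a; omega
        · have := (abs_le.1 (habs a)).2; omega
        · have := hhigh a; omega
      rw [vert_plaq, lay_site, hy, hka]
      have : -(((c : ℕ) : ZMod L) + ((k : ℤ) : ZMod L)) = ((c + 1 - k : ℕ) : ZMod L) := by
        have hL0 : ((2 * c + 1 : ℕ) : ZMod L) = 0 := by rw [← hL]; exact ZMod.natCast_self L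
        rw [Nat.cast_sub (by omega)]
        push_cast at hL0 ⊢
        linear_combination -hL0
      rw [this, val_cast (by omega)]
      omega
    · obtain ⟨k, hk1, hk, hka⟩ : ∃ k : ℕ, 1 ≤ k ∧ k ≤ 2 * B + 1 ∧ loff (lvert p 0) = (k : ℤ) := by
        refine ⟨(loff (lvert p 0)).toNat, ?_, ?_, ?_⟩
        · have := hhigh 0; omega
        · have := (abs_le.1 (habs 0)).2; omega
        · have := hhigh 0; omega
      rw [vert_plaq, lay_site, hy, hka]
      have : ((c : ℕ) : ZMod L) + ((k : ℤ) : ZMod L) = ((c + k : ℕ) : ZMod L) := by push_cast; ring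
      rw [this]
      intro h0
      have := congrArg ZMod.val h0
      rw [val_cast (by omega), ZMod.val_zero] at this
      omega

end Chart

end DiagRPHex

end Summit.QuantumFields.GaugeBoot
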